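import Summits.BirchSwinnertonDyer.BirchSwinnertonDyer.Theorems.Rank1ResidualJetThm63KernelInputsCM
import Summits.BirchSwinnertonDyer.BirchSwinnertonDyer.Theorems.Rank1ResidualJetRowDuality
import Literature.NumberTheory.EllipticCurves.HeegnerPointsKolyvaginExceptionalSelmerProofs
import HarnessLib

/-!
# T1 JET (cell `bsd-jet`), road K: [J] Thm 5.2 at a core vertex with the DUALITY INPUTS supplied —
# `tamagawaExponent_le_mInfty_of_kernelInputs'` WITHOUT `C'`, `hC`, `hdual_q`, `hdual_ℓ`

HONEST FRAMING (programme file §HONESTY, verbatim): «no tranche here proves BSD; ARM L moves the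
LITERAL column of an r ≤ 1 census into the kernel-proved-modulo-named-print column.» THEOREMS ONLY
(seat `bsd-jet-pv-1`, session g5; `--supports stmt-BirchSwinnertonDyer-14418`, helper); 0 classes
move. The assembly `JET.tamagawaExponent_le_mInfty_of_kernelInputs'` (pv-2) takes the two Poitou–Tate
packages `hdual_q` (Thm 5.1 + (δ) at the carrier) and `hdual_ℓ` (Lemma 5.2 (iii) at `λ`) and the dual
module `C'` with `hC` as hypotheses. This file feeds them from
`GlobalDuality.exists_rowDuality_modified` (the signed Poitou–Tate counting of the cell, the Weil
transport, the self-duality of `𝓕(c)`), so that the road-K line `t ≤ m_∞` now rests on: the named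
facts {[McC] Prop. 4.4 (`h44`), Gross Prop. 5.3 (`h53`), [GZ86 III (3.1)] (`hGZ`),
`poitouTate_selmerStructure_duality_conj` (`hPT`)}, the kernel gaps {`htr`, `hT`, `h49str`, `h49tr`}
(pv-2's list, unchanged), and — replacing `C'`/`hC`/`hdual_q`/`hdual_ℓ` — the LOCAL ∕ STRUCTURAL inputs
{a `τ`-equivariant Weil datum (`hτe`; bilinear/alternating/non-degenerate/`Γ_K`-equivariant are the
tree's PROVED `exists_weilPairing_holds`), `𝒯` `σ`-stable and self-dual at the primes of `c`, `𝒮`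
`σ`-stable at the carrier pair `{v₀, τv₀}` with `Kum_{v₀}/𝒮_{v₀}` cyclic of order `p^t` ((δ)), the
carrier `v₀ ∣ N_E` with `v₀ ≠ τ v₀`, and the Kolyvagin-prime local term
`(Kum_λ).relIndex (ker(σ_{*,λ} + e')) = p^k` (Lemma 5.2 (i)–(ii))}. `Qcar := {v₀, τ • v₀}`.
References: [cite: Jetchev2008, Thm. 5.1, Lemma 5.2, Thm. 5.2 and proof (pp. 821–823)]
[cite: Howard2004HeegnerKolyvagin, Thm. 2.1.11] [cite: MilneADT2006, Ch. I, Thm. 4.10]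
[cite: GrossLMS1991, §3, Prop. 5.3] [cite: McCallumLMS1991, Prop. 4.4].
-/

set_option autoImplicit false

noncomputable section

open scoped Classical Pointwise
open WeierstrassCurve IsDedekindDomain NumberField Field Literature.NumberTheory.EllipticCurves
  Literature.NumberTheory.EllipticCurves.ModularForms Literature.NumberTheory.EllipticCurves.Jetchev2008
  Literature.NumberTheory.GaloisRepresentations Literature.NumberTheory.GaloisCohomology
  Literature.NumberTheory.GaloisRepresentations.DiscreteGaloisModule
  Summit.BirchSwinnertonDyer.Rank1Residual.X11b

namespace Summit.BirchSwinnertonDyer.Rank1Residual.JET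

/-- **[J] Thm 5.2 at a core vertex, duality inputs supplied** — `tamagawaExponent_le_mInfty_of_kernelInputs'`
with `Qcar := {v₀, τ • v₀}` and `C'`, `hC`, `hdual_q`, `hdual_ℓ` produced by
`GlobalDuality.exists_rowDuality_modified` from: the named fact `hPT`, a `τ`-equivariant Weil datum
on `E[p^k]`, the `σ`-stability and self-duality of the transverse family `𝒯` at the primes of `c`, the
`σ`-stability of the stringent family `𝒮` at the carrier pair with `Kum_{v₀}/𝒮_{v₀}` cyclic of order
`p^t`, `v₀ ≠ τ v₀` above `N_E`, and the local term at the Kolyvagin primes. CONCLUSION: `t ≤ m_∞`.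
[cite: Jetchev2008, Thm. 5.2 (p. 821) and proof, Thm. 5.1, Lemma 5.2]
[cite: Howard2004HeegnerKolyvagin, Thm. 2.1.11] [cite: GrossLMS1991, Prop. 5.3] -/
theorem tamagawaExponent_le_mInfty_of_kernelInputs_duality
    (h44 : McCallum1991.prop44_localOrder_kolyvaginClass_mul_eq)
    (W : WeierstrassCurve ℚ) [W.IsElliptic] [W.IsGloballyMinimal] [NeZero (W.conductorNorm ℤ)]
    (hcm : ¬ W.HasCM) (K : Type) [Field K] [NumberField K] (hK : IsImaginaryQuadratic K)
    (hD3 : NumberField.discr K ≠ -3) (hD4 : NumberField.discr K ≠ -4)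
    (hH : SatisfiesHeegnerHypothesis (W.conductorNorm ℤ) K)
    (hPT : poitouTate_selmerStructure_duality_conj K)
    (p : ℕ) [Fact p.Prime] (hp2 : p ≠ 2) (htower : ∀ n : ℕ, W.HasSurjectiveModNGaloisRep (p ^ n : ℕ))
    (Dt : ModularParametrizationData W (W.conductorNorm ℤ)) (β : ℤ) (ι : K →+* ℂ)
    [∀ j : ℕ, NumberField (ringClassField K ι j)]
    (τ : K ≃ₐ[ℚ] K) (hτ : τ ≠ 1)
    (ε : ℤ) (hε : ε = 1 ∨ ε = -1)
    (h53 : ∀ (m : ℕ) (dm : KolyvaginHeegnerData Dt β ι m)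
      (τm : ringClassField K ι m ≃ₐ[ℚ] ringClassField K ι m),
      (∀ x : ringClassField K ι m, ((τm x : ringClassField K ι m) : ℂ) = starRingEnd ℂ x) →
      ∃ σ' ∈ ringClassGal ι m, IsOfFinAddOrder
        (pointGalHom W (ringClassField K ι m) τm dm.y -
          ε • pointGalHom W (ringClassField K ι m) σ' dm.y))
    {n' : ℤ} (hcop' : IsCoprime (p : ℤ) n')
    (hGZ : ∀ (m : ℕ) (dm : KolyvaginHeegnerData Dt β ι m)
      (γ : ringClassField K ι m ≃ₐ[ℚ] ringClassField K ι m), γ ∈ ringClassGal ι m →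
      ∀ v : HeightOneSpectrum (𝓞 K), ¬ (W.baseChange K).HasGoodReductionAt v →
        n' • pointsMap (W.baseChange K) (v.adicCompletion K)
            (dm.toGeomPoints (pointGalHom W (ringClassField K ι m) γ dm.y)) ∈
          E0Receptacle (W.baseChange K) v ∧
        ∀ (ℓ : ℕ), ℓ ∈ m.primeFactors → ∀ (dm' : KolyvaginHeegnerData Dt β ι (m / ℓ))
          (hle : ringClassField K ι (m / ℓ) ≤ ringClassField K ι m),
          n' • pointsMap (W.baseChange K) (v.adicCompletion K)
              (dm.toGeomPoints (pointGalHom W (ringClassField K ι m) γ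
                (WeierstrassCurve.Affine.Point.map (W' := W)
                  ((RingClassField.inclusion ι hle).restrictScalars ℚ) dm'.y))) ∈
            E0Receptacle (W.baseChange K) v)
    (mdiv m : {c : ℕ // Squarefree c ∧ ∀ ℓ ∈ c.primeFactors,
        Zhang2014.IsKolyvaginPrime (W.conductorNorm ℤ) W K p ℓ} → ℕ∞)
    (hmdiv : ∀ c (u : ℕ), (u : ℕ∞) ≤ mdiv c ↔ ∀ d : KolyvaginHeegnerData Dt β ι c.1,
      ∃ Q : (W.baseChange (ringClassField K ι c.1)).toAffine.Point,
        ((p ^ u : ℕ) : ℤ) • Q = d.derivedPoint)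
    (hm : ∀ c, m c = if mdiv c < Zhang2014.levelIndex W p c.1 then mdiv c else ⊤)
    (k : ℕ) (c : {c : ℕ // Squarefree c ∧ ∀ ℓ ∈ c.primeFactors,
        Zhang2014.IsKolyvaginPrime (W.conductorNorm ℤ) W K p ℓ}) (hk : 1 ≤ k)
    (hcore : IsGlobalCoreVertex W K ι τ p k c.1) (mInf : ℕ) (hmc : m c = mInf)
    (hkM : (k : ℕ∞) + mInf ≤ Zhang2014.levelIndex W p c.1)
    (t : ℕ) (htk : t < k) (hik : mInf < k)
    (𝒯 𝒮 : SelmerStructure ((W.baseChange K).torsionGaloisModule ((p ^ k : ℕ) : ℤ)))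
    (hT : ∀ x : galoisCohomology ((W.baseChange K).torsionGaloisModule ((p ^ k : ℕ) : ℤ)) 1,
      (∀ w ∈ placesDividing K c.1,
        galoisCohomology.localization ((W.baseChange K).torsionGaloisModule ((p ^ k : ℕ) : ℤ))
          (Sum.inr w) 1 x ∈ 𝒯 (Sum.inr w)) ↔
      ∀ ℓ ∈ c.1.primeFactors, x ∈ transverseKer W K ι ((p ^ k : ℕ) : ℤ) ℓ)
    (hS : ∀ v, 𝒮 v ≤ (W.baseChange K).kummerSelmerStructure ((p ^ k : ℕ) : ℤ) v)
    (e' : ℤ) (he' : e' = ε * (-1) ^ c.1.primeFactors.card)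
    [NeZero (p ^ k)] [Finite (geomTorsion (W.baseChange K) ((p ^ k : ℕ) : ℤ))]
    -- a Weil pairing datum on `E[p^k]` over `K`, equivariant under the lift of `τ`
    (e : geomTorsion (W.baseChange K) ((p ^ k : ℕ) : ℤ) → geomTorsion (W.baseChange K) ((p ^ k : ℕ) : ℤ) →
      AlgebraicClosure K)
    (hμ : ∀ S T, e S T ^ (p ^ k) = 1)
    (hadd₁ : ∀ S₁ S₂ T, e (S₁ + S₂) T = e S₁ T * e S₂ T)
    (hadd₂ : ∀ S T₁ T₂, e S (T₁ + T₂) = e S T₁ * e S T₂)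
    (hgal : ∀ (g : absoluteGaloisGroup K) (S T : geomTorsion (W.baseChange K) ((p ^ k : ℕ) : ℤ)),
      g • e S T = e (g • S) (g • T))
    (halt : ∀ T, e T T = 1) (hnondeg : ∀ T, (∀ S, e S T = 1) → T = 0)
    (hτe : ∀ S T, liftAut τ (e S T) =
      e ((isLiftOfAut_liftAut τ).torsionMap W ((p ^ k : ℕ) : ℤ) S)
        ((isLiftOfAut_liftAut τ).torsionMap W ((p ^ k : ℕ) : ℤ) T))
    -- the transverse family: `σ`-stable and self-dual at the primes dividing `c`
    (h𝒯σ : ∀ (v w : HeightOneSpectrum (𝓞 K)) (h : τ • v = w), v ∈ placesDividing K c.1 →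
      ∀ x : galoisCohomology (((W.baseChange K).torsionGaloisModule ((p ^ k : ℕ) : ℤ)).toLocal
        (Sum.inr v : Place K)) 1,
      x ∈ 𝒯 (Sum.inr v) → conjActPlace W τ ((p ^ k : ℕ) : ℤ) h x ∈ 𝒯 (Sum.inr w))
    (h𝒯sd : ∀ inv : LocalInvariants K (p ^ k), inv.IsPerfect → ∀ v ∈ placesDividing K c.1,
      inv.dualTransported 𝒯 (weilDualIntertwining (W.baseChange K) (p ^ k) e hμ hadd₁ hadd₂ hgal)
        (Sum.inr v) = 𝒯 (Sum.inr v))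
    -- the carrier pair `{v₀, τ v₀}` above `N_E` and the stringent family there ((δ): cyclic of order `p^t`)
    (v₀ : HeightOneSpectrum (𝓞 K)) (hv₀ : τ • v₀ ≠ v₀)
    (hQN : ((W.conductorNorm ℤ : ℕ) : 𝓞 K) ∈ v₀.asIdeal)
    (hQc : Disjoint ({v₀, τ • v₀} : Finset (HeightOneSpectrum (𝓞 K))) (placesDividing K c.1))
    (h𝒮σ : ∀ (v w : HeightOneSpectrum (𝓞 K)) (h : τ • v = w), v ∈ ({v₀, τ • v₀} : Finset _) →
      ∀ x : galoisCohomology (((W.baseChange K).torsionGaloisModule ((p ^ k : ℕ) : ℤ)).toLocal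
        (Sum.inr v : Place K)) 1,
      x ∈ 𝒮 (Sum.inr v) → conjActPlace W τ ((p ^ k : ℕ) : ℤ) h x ∈ 𝒮 (Sum.inr w))
    (hcyc : IsAddCyclic (↥((W.baseChange K).kummerSelmerStructure ((p ^ k : ℕ) : ℤ) (Sum.inr v₀)) ⧸
      (𝒮 (Sum.inr v₀)).addSubgroupOf ((W.baseChange K).kummerSelmerStructure ((p ^ k : ℕ) : ℤ) (Sum.inr v₀))))
    (hidx : (𝒮 (Sum.inr v₀)).relIndex
      ((W.baseChange K).kummerSelmerStructure ((p ^ k : ℕ) : ℤ) (Sum.inr v₀)) = p ^ t)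
    -- the local term at the Kolyvagin primes (Jetchev Lemma 5.2 (i)–(ii)), sign `−e'`
    (hloc : ∀ ℓ : ℕ, Zhang2014.IsKolyvaginPrime (W.conductorNorm ℤ) W K p ℓ → k ≤ Zhang2014.kolyvaginIndex W p ℓ →
      ℓ ∉ c.1.primeFactors → ∀ (v : HeightOneSpectrum (𝓞 K)), (ℓ : 𝓞 K) ∈ v.asIdeal → ∀ (hfix : τ • v = v),
      ((W.baseChange K).kummerSelmerStructure ((p ^ k : ℕ) : ℤ) (Sum.inr v)).relIndex
        ((conjActPlace W τ ((p ^ k : ℕ) : ℤ) hfix - (-e') • AddMonoidHom.id _).ker) = p ^ k)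
    (htr : ∀ (d : KolyvaginHeegnerData Dt β ι c.1), ∀ ℓ ∈ c.1.primeFactors,
      (d.kolyvaginClass (Fact.out : p.Prime) k :
        galoisCohomology ((W.baseChange K).torsionGaloisModule ((p ^ k : ℕ) : ℤ)) 1) ∈
        transverseKer W K ι ((p ^ k : ℕ) : ℤ) ℓ)
    (h49str : ∀ (ℓ : ℕ), Zhang2014.IsKolyvaginPrime (W.conductorNorm ℤ) W K p ℓ →
      k ≤ Zhang2014.kolyvaginIndex W p ℓ → ℓ ∉ c.1.primeFactors →
      ∀ (d' : KolyvaginHeegnerData Dt β ι (c.1 * ℓ)), ∀ q ∈ ({v₀, τ • v₀} : Finset (HeightOneSpectrum (𝓞 K))),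
      galoisCohomology.localization ((W.baseChange K).torsionGaloisModule ((p ^ k : ℕ) : ℤ))
          (Sum.inr q) 1 (d'.kolyvaginClass (Fact.out : p.Prime) k) ∈ 𝒮 (Sum.inr q))
    (h49tr : ∀ (ℓ : ℕ), Zhang2014.IsKolyvaginPrime (W.conductorNorm ℤ) W K p ℓ →
      k ≤ Zhang2014.kolyvaginIndex W p ℓ → ℓ ∉ c.1.primeFactors →
      ∀ (d' : KolyvaginHeegnerData Dt β ι (c.1 * ℓ)), ∀ w ∈ placesDividing K c.1,
      galoisCohomology.localization ((W.baseChange K).torsionGaloisModule ((p ^ k : ℕ) : ℤ))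
          (Sum.inr w) 1 (d'.kolyvaginClass (Fact.out : p.Prime) k) ∈ 𝒯 (Sum.inr w)) :
    t ≤ mInf := by
  have hp : p.Prime := Fact.out
  have hτ2 : τ * τ = 1 := mul_self_eq_one_of_isImaginaryQuadratic hK τ
  have hs : -e' = 1 ∨ -e' = -1 := by
    rcases hε with rfl | rfl <;> rcases neg_one_pow_eq_or ℤ c.1.primeFactors.card with h | h <;>
      simp [he', h]
  obtain ⟨C', hC, hdual_q, hdual_ℓ⟩ := GlobalDuality.exists_rowDuality_modified W τ p k e hμ hadd₁ hadd₂ hgal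
    halt hnondeg hτe hPT ι hτ2 hp2 hk 𝒯 𝒮 c.2.1.ne_zero hT h𝒯σ h𝒯sd hS v₀ hv₀ hQc h𝒮σ hcyc hidx
    (W.conductorNorm ℤ) hQN hs hloc
  exact tamagawaExponent_le_mInfty_of_kernelInputs' h44 W hcm K hK hD3 hD4 hH p hp2 htower Dt β ι τ hτ ε hε
    h53 hcop' hGZ mdiv m hmdiv hm k c hk hcore mInf hmc hkM t htk hik 𝒯 𝒮 hT hS {v₀, τ • v₀} hQc e' he'
    C' hC htr hdual_q h49str h49tr hdual_ℓ

end Summit.BirchSwinnertonDyer.Rank1Residual.JET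

end
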